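import Summits.HodgeConjecture.HodgeConjecture.Theorems.F0P3cStCharTSShellOrbitalH   -- ★ p849562 LH7-p04 (g2) D3-ii-H «SHELL-ORBITAL — H TWIN» (the inversion, `Ψ` by shape)
import Literature.NumberTheory.Automorphic.CMPrincipalSeriesJacquetEvalOne            -- ★ `continuous_proj_borelTriple`
import Literature.NumberTheory.Automorphic.CMPrincipalSeriesSpherical                -- ★ `rootDeltaChar_borel_eq_one_of_mem_isCompact`
import Literature.Topology.LocallyConstantCompactSupportUniform                      -- ★ uniform local constancy `exists_nhds_one_forall_mul_eq_of_hasCompactSupport`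
import HarnessLib

/-!
# F0 · P3c · line LH6 «StCharTS» — road (D) «DEEP-FL», brick D3-ii-H′ «THE LOCALLY CONSTANT VERSION OF THE NORMALISED CANONICAL ORBITAL INTEGRAL ON `T_H`»:
# the `(K_{2,v}, N₂)`-transform of a test function is locally constant (generic), its torus restriction has compact support, and it IS
# `δ_{B₂}^{1∕2} · J₂⁻¹ · O^{can}` at every regular good point — so D3-ii-H holds from the spectral data `hF1H` ALONE

Cell `pub/hodgecm-mathlib`, crux H413 = `stmt-HodgeConjecture-24833` (`--supports` lane, helper), route HCCMUnconditional; seat LH7-p04 (g2) (DEFAULT after ★ p849562, announced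
on the LH6 board 2026-09-02T05:38:43Z: «(α) Ψ-PRODUCER-H»); road owner LH6-p04 (g2) (`F0/P3b/LH6-p04/g2/ROAD-D.status.v4.txt` 6a6e64fd5094df6c § (c₄): «HEADs ending in
`classOrbitalIntegral m? f (ConjClasses.mk (ι t)) = closed form`»).  THEOREMS ONLY (★-only imports; no definition ∕ instance ∕ notation ∕ named fact ∕ `sorry`).  HONEST LABEL:
road-(D) brick, count-neutral — nothing here closes (S-X) `stub_StXIGSt`; HC_CM is proved only modulo the 7 printed citations (2 remaining: hLiu418 = stmt-HodgeConjecture-24832,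
h413 = stmt-HodgeConjecture-24833) until rung 0 closes.

THE MATHEMATICS ([Rogawski1990, §4.9 p. 55 «dg = dk dm du», §4.3 (4.3.1) p. 43]; [BernsteinZelevinsky1976, §1.1]; [HarishChandra1970, Part I §3]).  By ★ FILE 2′
`classOrbitalIntegral_prod_eq_smul_integral_prod_of_torus_regular_of_nonsplit`, at a regular diagonal `t ∈ T₂` and a `P_H`-good `(t, u)`,
  `O^{can}_{(t,u)}(f_H) = (c_F · J₂(t)) · ∫_{K_{2,v} × N₂} f_H(k (t n) k⁻¹, u) d(κ₂ ⊗ μ_N)`,   `c_F = ν_H(K_{2,v} × K_{1,v}) ∕ (κ₂(K_{2,v}) · μ_N(N₂ ∩ K_{2,v}))`,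
so the NORMALISED orbital integral `δ_{B₂}^{1∕2}(t) · J₂(t)⁻¹ · O^{can}_{(t,u)}(f_H)` is the restriction to the good points of the EVERYWHERE-DEFINED function
  `Ψ(t, u) := δ_{B₂}^{1∕2}(t) · c_F · ∫_{K_{2,v} × N₂} f_H(k (t n) k⁻¹, u) d(κ₂ ⊗ μ_N)`.
(§1, GENERIC) For ANY topological groups `A ⊇ K` compact, `N` closed, `U`, and `φ` locally constant with compact support on `A × U`, the transform
`(x, u) ↦ ∫_{K × N} φ(k (x n) k⁻¹, u) dμ` is LOCALLY CONSTANT on `A × U` for EVERY measure `μ` (the integrands at nearby points AGREE POINTWISE: `φ` is uniformly locally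
constant [BZ §1.1]; `k (x s n) k⁻¹ = (k (x n) k⁻¹) · (k n⁻¹ s n k⁻¹)` with the second factor small uniformly for `k ∈ K` and `n` in the compact set of relevant `n` — tube
lemma; off that set both integrands vanish).  (§2) On `T_H = T₂ × U(Φ₁)_v`: `δ_{B₂}^{1∕2}` is locally constant (`= 1` on `T₂ ∩ K_{2,v}`, ★ `rootDeltaChar_borel_eq_one_of_mem_isCompact`),
the support of `Ψ` lies in `proj(B₂ ∩ K_{2,v}⁻¹ Q K_{2,v}) × U(Φ₁)_v` (compact: ★ `continuous_proj_borelTriple`, `B₂` closed, `U(Φ₁)_v ⊆ K_{1,v}` compact), and `Ψ = δ^{1∕2} J₂⁻¹ O^{can}`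
at every regular good point (FILE 2′).  (§3) Feeding `Ψ` to ★ p849562 `classOrbitalIntegralH_eq_twoCoset_apply`: **from the spectral data `hF1H` alone**, at every regular `P_H`-good
`(t, u)`,  `O^{can}_{(t,u)}(f_H) = δ_{B₂}^{1∕2}(t)⁻¹ · J₂(t) · κ_H · (𝟙_{(b₁,z₁)(C₂×K₁)}(t,u) + κ·𝟙_{(b₂,z₁)(C₂×K₁)}(t,u))`, `κ_H = A · μ_T{t ∈ K_{2,v}} · ν₁(univ) ∕ (μ_T(C₂) · ν₁(K₁))`.
(`hF1H` is ★ p849597 `F0P3cStCharTSShellTracePSH.smoothTrace_cmPrincipalSeriesH_indicator_shell_eq_ite` (LH10-p02 (g2)) for the shell indicator, up to the consumer's choice of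
`(C₂, K₁, b₁, b₂, z₁, A, κ)`.)

* §1 `eventually_forall_conj_mul_eq` (pointwise agreement of the integrands near a point), `isLocallyConstant_integral_conj_mul` (the transform is locally constant).
* §2 **`exists_normalizedOrbitalIntegralH_version`** — `∃ Ψ` locally constant, compactly supported, `= δ^{1∕2} · J₂⁻¹ · O^{can}` at every regular good point.
* §3 **`classOrbitalIntegralH_eq_twoCoset_of_spectral`** — D3-ii-H's pointwise closed form from `hF1H` alone (the `Ψ`-hypotheses of ★ p849562 discharged).

## References
* [Rogawski1990] J. D. Rogawski, *Automorphic Representations of Unitary Groups in Three Variables*, Ann. of Math. Stud. 123 (1990), §4.3 (4.3.1) p. 43; §4.9 p. 55,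
  (4.9.4) p. 56; §12.7 Lemma 12.7.3 (proof) p. 195.
* [BernsteinZelevinsky1976] I. N. Bernstein, A. V. Zelevinsky, *Representations of the group GL(n, F) where F is a non-archimedean local field*, Russian Math.
  Surveys 31 (1976), §1.1.
* [HarishChandra1970] Harish-Chandra (notes by G. van Dijk), *Harmonic Analysis on Reductive p-adic Groups*, LNM 162 (1970), Part I §3 Lemmas 13–14.
-/

set_option autoImplicit false
-- the mandated namespace has the single-problem summit's repeated segment (`HodgeConjecture.HodgeConjecture`)
set_option linter.dupNamespace false

noncomputable section

open NumberField IsDedekindDomain MeasureTheory MeasureTheory.Measure Topology Filter Set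
open Literature.MeasureTheory.Group
open Literature.NumberTheory.Automorphic Literature.NumberTheory.Automorphic.UnitaryGroup
open Literature.NumberTheory.Automorphic.UnitaryGroup.HeisRing Literature.NumberTheory.Automorphic.UnitaryGroup.LineRing
open Literature.NumberTheory.Rogawski1990 (IsRegularElt)
open Summit.HodgeConjecture.HodgeConjecture.Cruxes.H413.F0P3cStCharTSShellOrbitalH
open scoped Matrix MatrixGroups NNReal ENNReal Classical

namespace Summit.HodgeConjecture.HodgeConjecture.Cruxes.H413.F0P3cStCharTSNormalizedOrbitalH

/-! ## §1 Generic: the `(K, N)`-conjugation transform of a locally constant compactly supported function is locally constant -/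

/-- **Pointwise agreement of the transform's integrands near a point.**  `A ⊇ K` compact, `N` closed, `U` any topological group, `φ : A × U → Y` locally constant with
compact support: near `(x, u)`, for ALL `k ∈ K` and `n ∈ N`, `φ (k (x′ n) k⁻¹, u′) = φ (k (x n) k⁻¹, u)`.  (Uniform local constancy of `φ`; `k (x s n) k⁻¹ = k (x n) k⁻¹ · k n⁻¹ s n k⁻¹`
with the tube lemma over `K ×` (the compact set of relevant `n`); off it both sides vanish.) [cite: BernsteinZelevinsky1976, §1.1] [cite: HarishChandra1970, Part I §3 Lemma 13] -/
theorem eventually_forall_conj_mul_eq {A U Y : Type*} [Group A] [TopologicalSpace A] [IsTopologicalGroup A] [LocallyCompactSpace A]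
    [Group U] [TopologicalSpace U] [IsTopologicalGroup U] [Zero Y]
    {φ : A × U → Y} (hφ : IsLocallyConstant φ) (hφc : HasCompactSupport φ)
    {K N : Set A} (hK : IsCompact K) (hN : IsClosed N) (x : A) (u : U) :
    ∀ᶠ q : A × U in 𝓝 (x, u), ∀ k ∈ K, ∀ n ∈ N, φ (k * (q.1 * n) * k⁻¹, q.2) = φ (k * (x * n) * k⁻¹, u) := by
  -- uniform local constancy of `φ` (right translations by `V ∈ 𝓝 1`), split along the two factors
  obtain ⟨V, hV, hφV⟩ := Literature.Topology.exists_nhds_one_forall_mul_eq_of_hasCompactSupport hφ hφc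
  rw [← Prod.mk_one_one] at hV
  obtain ⟨V₂, hV₂, V₁, hV₁, hVsub⟩ := mem_nhds_prod_iff.1 hV
  -- a compact neighbourhood `S₀` of `1` in `A`; the relevant `n` lie in a compact set `C`
  obtain ⟨S₀, hS₀c, hS₀⟩ := exists_compact_mem_nhds (1 : A)
  have h1S₀ : (1 : A) ∈ S₀ := mem_of_mem_nhds hS₀
  have hQ₂c : IsCompact (Prod.fst '' tsupport φ) := hφc.image continuous_fst
  have hQ₂'c : IsCompact ((fun p : A × A => p.1⁻¹ * p.2 * p.1) '' (K ×ˢ (Prod.fst '' tsupport φ))) :=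
    (hK.prod hQ₂c).image (by fun_prop)
  set C : Set A := N ∩ ((fun p : A × A => (x * p.1)⁻¹ * p.2) '' (S₀ ×ˢ ((fun p : A × A => p.1⁻¹ * p.2 * p.1) '' (K ×ˢ (Prod.fst '' tsupport φ))))) with hC
  have hCc : IsCompact C := by
    rw [hC, Set.inter_comm]
    exact ((hS₀c.prod hQ₂'c).image (by fun_prop)).inter_right hN
  -- off `C`, the integrand vanishes at every base point `x s`, `s ∈ S₀`
  have hoff : ∀ s ∈ S₀, ∀ k ∈ K, ∀ n ∈ N, n ∉ C → ∀ u' : U, φ (k * (x * s * n) * k⁻¹, u') = 0 := by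
    intro s hs k hk n hn hnC u'
    by_contra hne
    have hmem : (k * (x * s * n) * k⁻¹, u') ∈ tsupport φ := subset_tsupport _ hne
    have hq : k * (x * s * n) * k⁻¹ ∈ Prod.fst '' tsupport φ := ⟨_, hmem, rfl⟩
    have hq' : x * s * n ∈ (fun p : A × A => p.1⁻¹ * p.2 * p.1) '' (K ×ˢ (Prod.fst '' tsupport φ)) := by
      refine ⟨(k, k * (x * s * n) * k⁻¹), ⟨hk, hq⟩, ?_⟩
      show k⁻¹ * (k * (x * s * n) * k⁻¹) * k = x * s * n
      group
    apply hnC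
    refine ⟨hn, (s, x * s * n), ⟨hs, hq'⟩, ?_⟩
    show (x * s)⁻¹ * (x * s * n) = n
    group
  -- on `C`, conjugating a small `s` by `n⁻¹` and `k` stays in `V₂` (tube lemma over the compact `K ×ˢ C`)
  have hcont : Continuous fun z : A × (A × A) => z.2.1 * z.2.2⁻¹ * z.1 * z.2.2 * z.2.1⁻¹ := by fun_prop
  have htube : ∀ᶠ s in 𝓝 (1 : A), ∀ kn ∈ K ×ˢ C, kn.1 * kn.2⁻¹ * s * kn.2 * kn.1⁻¹ ∈ V₂ := by
    refine (hK.prod hCc).eventually_forall_of_forall_eventually fun kn _ => ?_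
    have hpre := hcont.continuousAt.preimage_mem_nhds (x := ((1 : A), kn))
      (by simpa only [mul_one, inv_mul_cancel_right, mul_inv_cancel] using hV₂)
    exact Filter.mem_of_superset hpre fun z hz => hz
  -- the neighbourhood of `(x, u)`
  have hTs : {s : A | ∀ kn ∈ K ×ˢ C, kn.1 * kn.2⁻¹ * s * kn.2 * kn.1⁻¹ ∈ V₂} ∩ S₀ ∈ 𝓝 (1 : A) := Filter.inter_mem htube hS₀
  have hmap : Continuous fun q : A × U => (x⁻¹ * q.1, u⁻¹ * q.2) := by fun_prop
  have hW : (fun q : A × U => (x⁻¹ * q.1, u⁻¹ * q.2)) ⁻¹' (({s : A | ∀ kn ∈ K ×ˢ C, kn.1 * kn.2⁻¹ * s * kn.2 * kn.1⁻¹ ∈ V₂} ∩ S₀) ×ˢ V₁) ∈ 𝓝 (x, u) := by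
    refine hmap.continuousAt.preimage_mem_nhds ?_
    simpa only [inv_mul_cancel] using prod_mem_nhds hTs hV₁
  refine Filter.mem_of_superset hW ?_
  rintro ⟨x', u'⟩ ⟨⟨hs, hs₀⟩, hr⟩ k hk n hn
  -- write `x' = x s`, `u' = u r`
  have hx' : x' = x * (x⁻¹ * x') := by rw [mul_inv_cancel_left]
  have hu' : u' = u * (u⁻¹ * u') := by rw [mul_inv_cancel_left]
  by_cases hnC : n ∈ C
  · -- `k (x s n) k⁻¹ = (k (x n) k⁻¹) · (k n⁻¹ s n k⁻¹)`, the second factor in `V₂`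
    have hc : k * (x' * n) * k⁻¹ = (k * (x * n) * k⁻¹) * (k * n⁻¹ * (x⁻¹ * x') * n * k⁻¹) := by group
    have hmemV : ((k * n⁻¹ * (x⁻¹ * x') * n * k⁻¹, u⁻¹ * u') : A × U) ∈ V := hVsub ⟨hs (k, n) ⟨hk, hnC⟩, hr⟩
    have := hφV (k * (x * n) * k⁻¹, u) _ hmemV
    rw [Prod.mk_mul_mk, ← hc, ← hu'] at this
    exact this
  · -- both sides vanish
    have h0 : φ (k * (x' * n) * k⁻¹, u') = 0 := by
      have := hoff (x⁻¹ * x') hs₀ k hk n hn hnC u'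
      rwa [← hx'] at this
    have h0' : φ (k * (x * n) * k⁻¹, u) = 0 := by
      have := hoff 1 h1S₀ k hk n hn hnC u
      rwa [mul_one] at this
    rw [h0, h0']

/-- **The `(K, N)`-conjugation transform is locally constant** (any measure on `↥K × ↥N`): `(x, u) ↦ ∫ φ (k (x n) k⁻¹, u) dμ(k, n)` is locally constant on `A × U` for
`φ` locally constant with compact support, `K` compact, `N` closed — the integrands at nearby points agree pointwise (`eventually_forall_conj_mul_eq`).
[cite: BernsteinZelevinsky1976, §1.1] [cite: Rogawski1990, §4.3 (4.3.1) p. 43] -/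
theorem isLocallyConstant_integral_conj_mul {A U E : Type*} [Group A] [TopologicalSpace A] [IsTopologicalGroup A] [LocallyCompactSpace A]
    [Group U] [TopologicalSpace U] [IsTopologicalGroup U] [NormedAddCommGroup E] [NormedSpace ℝ E]
    {φ : A × U → E} (hφ : IsLocallyConstant φ) (hφc : HasCompactSupport φ)
    (K N : Subgroup A) (hK : IsCompact (K : Set A)) (hN : IsClosed (N : Set A))
    [MeasurableSpace (↥K × ↥N)] (μ : Measure (↥K × ↥N)) :
    IsLocallyConstant fun q : A × U => ∫ p : ↥K × ↥N, φ ((p.1 : A) * (q.1 * (p.2 : A)) * (p.1 : A)⁻¹, q.2) ∂μ := by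
  refine (IsLocallyConstant.iff_eventually_eq _).2 fun q => ?_
  obtain ⟨x, u⟩ := q
  refine (eventually_forall_conj_mul_eq hφ hφc hK hN x u).mono fun q hq => ?_
  exact integral_congr_ae (Filter.Eventually.of_forall fun p => hq p.1 p.1.2 p.2 p.2.2)

/-! ## §2 The locally constant, compactly supported version of the normalised canonical orbital integral on `T_H = T₂ × U(Φ₁)_v` -/

section CM

variable (L : Type) [Field L] [NumberField L] [IsCMField L]

set_option maxHeartbeats 3200000 in
set_option synthInstance.maxHeartbeats 400000 in
/-- **D3-ii-H′ — THE VERSION `Ψ` EXISTS.**  Frame = ★ FILE 2′ ∕ ★ (4.9.4)-H (`v` non-split; Borel structure and Haar `ν_H` on `H_v = U(Φ₂)_v × U(Φ₁)_v`; `m_H` canonical for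
`(P_H, ν_H)`; Borel structures on the factors; `U(Φ₁)_v ⊆ K_{1,v}`); `f_H` locally constant with compact support.  Then there is `Ψ : T₂ × U(Φ₁)_v → ℂ`, LOCALLY CONSTANT with
COMPACT SUPPORT, such that at EVERY `t ∈ T₂` with a diagonal writing `t = diag(d)` (`d₀⁻¹d₁ − 1` a unit), `t` regular, and every `u` with `(t, u)` `P_H`-good,
`Ψ (t, u) = δ_{B₂}^{1∕2}(t) · J₂(t)⁻¹ · classOrbitalIntegral m_H f_H ⟦(t, u)⟧` (`J₂(t) = χ⁻(d₀⁻¹d₁ − 1)⁻¹`) — namely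
`Ψ = δ_{B₂}^{1∕2} · c_F · ∫_{K_{2,v} × N₂} f_H(k (t n) k⁻¹, u) d(κ₂ ⊗ μ_N)`, `c_F = ν_H(K_{2,v} × K_{1,v}) ∕ (κ₂(univ) · μ_N(N₂ ∩ K_{2,v}))` for Haar `κ₂`, `μ_N`.
[cite: Rogawski1990, §4.9 p. 55; §4.3 (4.3.1) p. 43] [cite: BernsteinZelevinsky1976, §1.1] [cite: HarishChandra1970, Part I §3 Lemmas 13–14] -/
theorem exists_normalizedOrbitalIntegralH_version
    {v : HeightOneSpectrum (𝓞 ↥(maximalRealSubfield L))} (w : PlacesOver L v) (hw : IsCMField.complexConj L • w.1 = w.1)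
    [mHH : MeasurableSpace (((cmDatum L 2 (Matrix.of fun i j : Fin 2 => if i.val + j.val + 1 = 2 then (1 : L) else 0)).Local v) × ((cmDatum L 1 (Matrix.of fun i j : Fin 1 => if i.val + j.val + 1 = 1 then (1 : L) else 0)).Local v))] [BorelSpace (((cmDatum L 2 (Matrix.of fun i j : Fin 2 => if i.val + j.val + 1 = 2 then (1 : L) else 0)).Local v) × ((cmDatum L 1 (Matrix.of fun i j : Fin 1 => if i.val + j.val + 1 = 1 then (1 : L) else 0)).Local v))]
    [∀ a : (((cmDatum L 2 (Matrix.of fun i j : Fin 2 => if i.val + j.val + 1 = 2 then (1 : L) else 0)).Local v) × ((cmDatum L 1 (Matrix.of fun i j : Fin 1 => if i.val + j.val + 1 = 1 then (1 : L) else 0)).Local v)), MeasurableSpace ((((cmDatum L 2 (Matrix.of fun i j : Fin 2 => if i.val + j.val + 1 = 2 then (1 : L) else 0)).Local v) × ((cmDatum L 1 (Matrix.of fun i j : Fin 1 => if i.val + j.val + 1 = 1 then (1 : L) else 0)).Local v)) ⧸ Subgroup.centralizer ({a} : Set (((cmDatum L 2 (Matrix.of fun i j : Fin 2 => if i.val +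 j.val + 1 = 2 then (1 : L) else 0)).Local v) × ((cmDatum L 1 (Matrix.of fun i j : Fin 1 => if i.val + j.val + 1 = 1 then (1 : L) else 0)).Local v))))]
    [∀ a : (((cmDatum L 2 (Matrix.of fun i j : Fin 2 => if i.val + j.val + 1 = 2 then (1 : L) else 0)).Local v) × ((cmDatum L 1 (Matrix.of fun i j : Fin 1 => if i.val + j.val + 1 = 1 then (1 : L) else 0)).Local v)), BorelSpace ((((cmDatum L 2 (Matrix.of fun i j : Fin 2 => if i.val + j.val + 1 = 2 then (1 : L) else 0)).Local v) × ((cmDatum L 1 (Matrix.of fun i j : Fin 1 => if i.val + j.val + 1 = 1 then (1 : L) else 0)).Local v)) ⧸ Subgroup.centralizer ({a} : Set (((cmDatum L 2 (Matrix.of fun i j : Fin 2 => if i.val + j.val + 1 = 2 then (1 : L) else 0)).Local v) × ((cmDatum L 1 (Matrix.of fun i j : Fin 1 => if i.val + j.val + 1 = 1 then (1 : L) else 0)).Local v))))]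
    (νH : Measure (((cmDatum L 2 (Matrix.of fun i j : Fin 2 => if i.val + j.val + 1 = 2 then (1 : L) else 0)).Local v) × ((cmDatum L 1 (Matrix.of fun i j : Fin 1 => if i.val + j.val + 1 = 1 then (1 : L) else 0)).Local v))) [νH.IsHaarMeasure] [νH.IsMulRightInvariant]
    {P_H : (((cmDatum L 2 (Matrix.of fun i j : Fin 2 => if i.val + j.val + 1 = 2 then (1 : L) else 0)).Local v) × ((cmDatum L 1 (Matrix.of fun i j : Fin 1 => if i.val + j.val + 1 = 1 then (1 : L) else 0)).Local v)) → Prop} {mH : OrbitalMeasureFamily (((cmDatum L 2 (Matrix.of fun i j : Fin 2 => if i.val + j.val + 1 = 2 then (1 : L) else 0)).Local v) × ((cmDatum L 1 (Matrix.of fun i j : Fin 1 => if i.val + j.val + 1 = 1 then (1 : L) else 0)).Local v))} (hmH : mH.IsCanonical P_H νH)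
    [MeasurableSpace ↥(unitaryGroupOfForm (conjLocal L (IsCMField.complexConj L) v) (cmLocalForm L 2 v))] [BorelSpace ↥(unitaryGroupOfForm (conjLocal L (IsCMField.complexConj L) v) (cmLocalForm L 2 v))] [MeasurableSpace ((cmDatum L 1 (Matrix.of fun i j : Fin 1 => if i.val + j.val + 1 = 1 then (1 : L) else 0)).Local v)] [BorelSpace ((cmDatum L 1 (Matrix.of fun i j : Fin 1 => if i.val + j.val + 1 = 1 then (1 : L) else 0)).Local v)]
    (hK₁ : ∀ x : ((cmDatum L 1 (Matrix.of fun i j : Fin 1 => if i.val + j.val + 1 = 1 then (1 : L) else 0)).Local v), x ∈ cmLocalIntegralLevel L 1 (Matrix.of fun i j : Fin 1 => if i.val + j.val + 1 = 1 then (1 : L) else 0) v)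
    (fH : (((cmDatum L 2 (Matrix.of fun i j : Fin 2 => if i.val + j.val + 1 = 2 then (1 : L) else 0)).Local v) × ((cmDatum L 1 (Matrix.of fun i j : Fin 1 => if i.val + j.val + 1 = 1 then (1 : L) else 0)).Local v)) → ℂ) (hfH : IsLocallyConstant fH) (hfHc : HasCompactSupport fH) :
    ∃ Ψ : ↥(cmBorelTriple L 2 v).M × ((cmDatum L 1 (Matrix.of fun i j : Fin 1 => if i.val + j.val + 1 = 1 then (1 : L) else 0)).Local v) → ℂ, IsLocallyConstant Ψ ∧ HasCompactSupport Ψ ∧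
      (haveI := locallyCompactSpace_cmBorelU L 2 v
      ∀ (t : ↥(cmBorelTriple L 2 v).M) (u : ((cmDatum L 1 (Matrix.of fun i j : Fin 1 => if i.val + j.val + 1 = 1 then (1 : L) else 0)).Local v)) (d : Fin 2 → (LocalRing L v)ˣ)
        (hd : glDiagonal 2 (LocalRing L v) d = ((t : ↥(unitaryGroupOfForm (conjLocal L (IsCMField.complexConj L) v) (cmLocalForm L 2 v))) : GL (Fin 2) (LocalRing L v)))
        (hb : IsUnit ((((d 0)⁻¹ * d 1 : (LocalRing L v)ˣ) : LocalRing L v) - 1)),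
        IsRegularElt ((t : ↥(unitaryGroupOfForm (conjLocal L (IsCMField.complexConj L) v) (cmLocalForm L 2 v))) : GL (Fin 2) (LocalRing L v)) → P_H (Quotient.out (ConjClasses.mk (((t : ↥(unitaryGroupOfForm (conjLocal L (IsCMField.complexConj L) v) (cmLocalForm L 2 v))) : ((cmDatum L 2 (Matrix.of fun i j : Fin 2 => if i.val + j.val + 1 = 2 then (1 : L) else 0)).Local v)), u))) →
        Ψ (t, u) =
            ((rootDeltaChar (cmBorelTriple L 2 v).P ⟨(t : ↥(unitaryGroupOfForm (conjLocal L (IsCMField.complexConj L) v) (cmLocalForm L 2 v))), (cmBorelTriple L 2 v).M_le t.2⟩ : ℂˣ) : ℂ) *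
          ((((letI : MeasurableSpace (LocalRing L v) := borel _; haveI : BorelSpace (LocalRing L v) := ⟨rfl⟩
            haveI : SecondCountableTopology (LocalRing L v) := secondCountableTopology_localRing (E := L) v
            ((skewModulus (conjLocal L (IsCMField.complexConj L) v) (continuous_conjLocal L (IsCMField.complexConj L) v) hb.unit
              (map_unit_torusScalar_sub_one_two (conjLocal L (IsCMField.complexConj L) v) (cmLocalForm_eq_over L 2 v)
                (⟨(t : ↥(unitaryGroupOfForm (conjLocal L (IsCMField.complexConj L) v) (cmLocalForm L 2 v))), t.2⟩ : ↥(torusU (conjLocal L (IsCMField.complexConj L) v) (cmLocalForm L 2 v))) hd hb))⁻¹ : ℝ≥0)) : ℝ) : ℂ))⁻¹ *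
          classOrbitalIntegral mH fH (ConjClasses.mk (((t : ↥(unitaryGroupOfForm (conjLocal L (IsCMField.complexConj L) v) (cmLocalForm L 2 v))) : ((cmDatum L 2 (Matrix.of fun i j : Fin 2 => if i.val + j.val + 1 = 2 then (1 : L) else 0)).Local v)), u))) := by
  haveI := locallyCompactSpace_cmBorelU L 2 v
  -- topological ∕ measurable bookkeeping on the factors (both spellings)
  letI : MeasurableSpace ((cmDatum L 2 (Matrix.of fun i j : Fin 2 => if i.val + j.val + 1 = 2 then (1 : L) else 0)).Local v) := ‹MeasurableSpace ↥(unitaryGroupOfForm (conjLocal L (IsCMField.complexConj L) v) (cmLocalForm L 2 v))›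
  haveI : BorelSpace ((cmDatum L 2 (Matrix.of fun i j : Fin 2 => if i.val + j.val + 1 = 2 then (1 : L) else 0)).Local v) := ‹BorelSpace ↥(unitaryGroupOfForm (conjLocal L (IsCMField.complexConj L) v) (cmLocalForm L 2 v))›
  haveI : LocallyCompactSpace ↥(unitaryGroupOfForm (conjLocal L (IsCMField.complexConj L) v) (cmLocalForm L 2 v)) := locallyCompactSpace_local (IsCMField.complexConj L) 2 _ v
  haveI : SecondCountableTopology ↥(unitaryGroupOfForm (conjLocal L (IsCMField.complexConj L) v) (cmLocalForm L 2 v)) := secondCountableTopology_local (IsCMField.complexConj L) 2 _ v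
  haveI : T2Space ↥(unitaryGroupOfForm (conjLocal L (IsCMField.complexConj L) v) (cmLocalForm L 2 v)) := t2Space_cmDatum_local 2 L (Matrix.of fun i j : Fin 2 => if i.val + j.val + 1 = 2 then (1 : L) else 0) v
  haveI : LocallyCompactSpace ((cmDatum L 1 (Matrix.of fun i j : Fin 1 => if i.val + j.val + 1 = 1 then (1 : L) else 0)).Local v) := locallyCompactSpace_local (IsCMField.complexConj L) 1 _ v
  haveI : SecondCountableTopology ((cmDatum L 1 (Matrix.of fun i j : Fin 1 => if i.val + j.val + 1 = 1 then (1 : L) else 0)).Local v) := secondCountableTopology_local (IsCMField.complexConj L) 1 _ v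
  haveI : T2Space ((cmDatum L 1 (Matrix.of fun i j : Fin 1 => if i.val + j.val + 1 = 1 then (1 : L) else 0)).Local v) := t2Space_cmDatum_local 1 L (Matrix.of fun i j : Fin 1 => if i.val + j.val + 1 = 1 then (1 : L) else 0) v
  haveI : NonarchimedeanGroup ↥(unitaryGroupOfForm (conjLocal L (IsCMField.complexConj L) v) (cmLocalForm L 2 v)) := nonarchimedeanGroup_cmLocal L 2 v
  haveI : NonarchimedeanGroup ((cmDatum L 1 (Matrix.of fun i j : Fin 1 => if i.val + j.val + 1 = 1 then (1 : L) else 0)).Local v) := nonarchimedeanGroup_cmLocal L 1 v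
  haveI : LocallyCompactSpace ((cmDatum L 2 (Matrix.of fun i j : Fin 2 => if i.val + j.val + 1 = 2 then (1 : L) else 0)).Local v) := ‹LocallyCompactSpace ↥(unitaryGroupOfForm (conjLocal L (IsCMField.complexConj L) v) (cmLocalForm L 2 v))›
  haveI : SecondCountableTopology ((cmDatum L 2 (Matrix.of fun i j : Fin 2 => if i.val + j.val + 1 = 2 then (1 : L) else 0)).Local v) := ‹SecondCountableTopology ↥(unitaryGroupOfForm (conjLocal L (IsCMField.complexConj L) v) (cmLocalForm L 2 v))›
  haveI : T2Space ((cmDatum L 2 (Matrix.of fun i j : Fin 2 => if i.val + j.val + 1 = 2 then (1 : L) else 0)).Local v) := ‹T2Space ↥(unitaryGroupOfForm (conjLocal L (IsCMField.complexConj L) v) (cmLocalForm L 2 v))›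
  haveI : T1Space (LocalRing L v) := inferInstance
  -- `K₂ = K_{2,v}` compact open; `N₂`, `B₂`, `T₂` closed; Haar measures `κ₂` on `K₂`, `μ_N` on `N₂`
  set K₂ : Subgroup ↥(unitaryGroupOfForm (conjLocal L (IsCMField.complexConj L) v) (cmLocalForm L 2 v)) := cmLocalIntegralLevel L 2 (Matrix.of fun i j : Fin 2 => if i.val + j.val + 1 = 2 then (1 : L) else 0) v with hK2
  have hKco := isCompact_isOpen_cmLocalIntegralLevel L 2 (Matrix.of fun i j : Fin 2 => if i.val + j.val + 1 = 2 then (1 : L) else 0) v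
  have hKc : IsCompact (K₂ : Set ↥(unitaryGroupOfForm (conjLocal L (IsCMField.complexConj L) v) (cmLocalForm L 2 v))) := hKco.1
  have hKo : IsOpen (K₂ : Set ↥(unitaryGroupOfForm (conjLocal L (IsCMField.complexConj L) v) (cmLocalForm L 2 v))) := hKco.2
  haveI : CompactSpace ↥K₂ := isCompact_iff_compactSpace.1 hKc
  have hNcl : IsClosed ((cmBorelTriple L 2 v).N : Set ↥(unitaryGroupOfForm (conjLocal L (IsCMField.complexConj L) v) (cmLocalForm L 2 v))) :=
    (isClosed_upperUnitriangular (n := 2) (R := LocalRing L v)).preimage continuous_subtype_val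
  have hBcl : IsClosed ((cmBorelTriple L 2 v).P : Set ↥(unitaryGroupOfForm (conjLocal L (IsCMField.complexConj L) v) (cmLocalForm L 2 v))) := isClosed_borelU (conjLocal L (IsCMField.complexConj L) v) (cmLocalForm L 2 v)
  have hTcl := isClosed_torusU_of_t1Space (conjLocal L (IsCMField.complexConj L) v) (cmLocalForm L 2 v)
  haveI : LocallyCompactSpace ↥(cmBorelTriple L 2 v).N := hNcl.isClosedEmbedding_subtypeVal.locallyCompactSpace
  haveI : SecondCountableTopology ↥(cmBorelTriple L 2 v).N := TopologicalSpace.Subtype.secondCountableTopology _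
  haveI : SigmaCompactSpace ↥(cmBorelTriple L 2 v).N := sigmaCompactSpace_of_locallyCompact_secondCountable
  let κ₂ : Measure ↥K₂ := Measure.haar
  let μN₂ : Measure ↥(cmBorelTriple L 2 v).N := Measure.haar
  haveI : SigmaFinite μN₂ := inferInstance
  -- `U(Φ₁)_v` is compact
  have hK1univ : ((cmLocalIntegralLevel L 1 (Matrix.of fun i j : Fin 1 => if i.val + j.val + 1 = 1 then (1 : L) else 0) v : Subgroup ((cmDatum L 1 (Matrix.of fun i j : Fin 1 => if i.val + j.val + 1 = 1 then (1 : L) else 0)).Local v)) : Set ((cmDatum L 1 (Matrix.of fun i j : Fin 1 => if i.val + j.val + 1 = 1 then (1 : L) else 0)).Local v)) = Set.univ := Set.eq_univ_of_forall fun x => hK₁ x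
  have hU1c : IsCompact (Set.univ : Set ((cmDatum L 1 (Matrix.of fun i j : Fin 1 => if i.val + j.val + 1 = 1 then (1 : L) else 0)).Local v)) := by rw [← hK1univ]; exact (isCompact_isOpen_cmLocalIntegralLevel L 1 (Matrix.of fun i j : Fin 1 => if i.val + j.val + 1 = 1 then (1 : L) else 0) v).1
  -- THE VERSION
  set cF : ℝ≥0∞ := νH ((((cmLocalIntegralLevel L 2 (Matrix.of fun i j : Fin 2 => if i.val + j.val + 1 = 2 then (1 : L) else 0) v).prod (cmLocalIntegralLevel L 1 (Matrix.of fun i j : Fin 1 => if i.val + j.val + 1 = 1 then (1 : L) else 0) v)) : Subgroup (((cmDatum L 2 (Matrix.of fun i j : Fin 2 => if i.val + j.val + 1 = 2 then (1 : L) else 0)).Local v) × ((cmDatum L 1 (Matrix.of fun i j : Fin 1 => if i.val + j.val + 1 = 1 then (1 : L) else 0)).Local v))) : Set (((cmDatum L 2 (Matrix.of fun i j : Fin 2 => if i.val + j.val + 1 = 2 then (1 : L) else 0)).Local v) × ((cmDatum L 1 (Matrix.of fun i j : Fin 1 => if i.val + j.val + 1 = 1 then (1 : L) else 0)).Local v)))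 /
      (κ₂ Set.univ * μN₂ {n | (n : ↥(unitaryGroupOfForm (conjLocal L (IsCMField.complexConj L) v) (cmLocalForm L 2 v))) ∈ K₂}) with hcF
  refine ⟨fun q : ↥(cmBorelTriple L 2 v).M × ((cmDatum L 1 (Matrix.of fun i j : Fin 1 => if i.val + j.val + 1 = 1 then (1 : L) else 0)).Local v) =>
      ((rootDeltaChar (cmBorelTriple L 2 v).P ⟨(q.1 : ↥(unitaryGroupOfForm (conjLocal L (IsCMField.complexConj L) v) (cmLocalForm L 2 v))), (cmBorelTriple L 2 v).M_le q.1.2⟩ : ℂˣ) : ℂ) * ((cF.toReal : ℝ) : ℂ) *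
        ∫ p : ↥K₂ × ↥(cmBorelTriple L 2 v).N,
          fH ((((p.1 : ↥(unitaryGroupOfForm (conjLocal L (IsCMField.complexConj L) v) (cmLocalForm L 2 v))) * ((q.1 : ↥(unitaryGroupOfForm (conjLocal L (IsCMField.complexConj L) v) (cmLocalForm L 2 v))) * (p.2 : ↥(unitaryGroupOfForm (conjLocal L (IsCMField.complexConj L) v) (cmLocalForm L 2 v)))) * (p.1 : ↥(unitaryGroupOfForm (conjLocal L (IsCMField.complexConj L) v) (cmLocalForm L 2 v)))⁻¹ : ↥(unitaryGroupOfForm (conjLocal L (IsCMField.complexConj L) v) (cmLocalForm L 2 v))) : ((cmDatum L 2 (Matrix.of fun i j : Fin 2 => if i.val + j.val + 1 = 2 then (1 : L) else 0)).Local v)), q.2) ∂(κ₂.prod μN₂),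
    ?_, ?_, ?_⟩
  · -- LOCALLY CONSTANT: `δ^{1∕2}` is `T₂ ∩ K_{2,v}`-invariant; the transform by §1 along `(t, u) ↦ (↑t, u)`
    have hδ : IsLocallyConstant fun t : ↥(cmBorelTriple L 2 v).M =>
        ((rootDeltaChar (cmBorelTriple L 2 v).P ⟨(t : ↥(unitaryGroupOfForm (conjLocal L (IsCMField.complexConj L) v) (cmLocalForm L 2 v))), (cmBorelTriple L 2 v).M_le t.2⟩ : ℂˣ) : ℂ) := by
      refine isLocallyConstant_of_forall_mul_mem_eq (K₂.comap (cmBorelTriple L 2 v).M.subtype)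
        (hKo.preimage continuous_subtype_val) _ fun t c hc => ?_
      have hmul : (⟨((t * c : ↥(cmBorelTriple L 2 v).M) : ↥(unitaryGroupOfForm (conjLocal L (IsCMField.complexConj L) v) (cmLocalForm L 2 v))), (cmBorelTriple L 2 v).M_le (t * c).2⟩ : ↥(cmBorelTriple L 2 v).P) =
          ⟨(t : ↥(unitaryGroupOfForm (conjLocal L (IsCMField.complexConj L) v) (cmLocalForm L 2 v))), (cmBorelTriple L 2 v).M_le t.2⟩ * ⟨(c : ↥(unitaryGroupOfForm (conjLocal L (IsCMField.complexConj L) v) (cmLocalForm L 2 v))), (cmBorelTriple L 2 v).M_le c.2⟩ := rfl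
      rw [hmul, map_mul, Units.val_mul,
        rootDeltaChar_borel_eq_one_of_mem_isCompact (conjLocal L (IsCMField.complexConj L) v) (cmLocalForm L 2 v) (cmLocalForm_eq_over L 2 v) hKc
          ⟨(c : ↥(unitaryGroupOfForm (conjLocal L (IsCMField.complexConj L) v) (cmLocalForm L 2 v))), (cmBorelTriple L 2 v).M_le c.2⟩ (Subgroup.mem_comap.1 hc),
        Units.val_one, mul_one]
    -- re-spell `fH` on `U(Φ₂)_v × U(Φ₁)_v` (the `unitaryGroupOfForm` carrier of the first factor; definitional)
    have hfH' : IsLocallyConstant (fun x : ↥(unitaryGroupOfForm (conjLocal L (IsCMField.complexConj L) v) (cmLocalForm L 2 v)) × ((cmDatum L 1 (Matrix.of fun i j : Fin 1 => if i.val + j.val + 1 = 1 then (1 : L) else 0)).Local v) => fH x) := hfH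
    have hfHc' : HasCompactSupport (fun x : ↥(unitaryGroupOfForm (conjLocal L (IsCMField.complexConj L) v) (cmLocalForm L 2 v)) × ((cmDatum L 1 (Matrix.of fun i j : Fin 1 => if i.val + j.val + 1 = 1 then (1 : L) else 0)).Local v) => fH x) := hfHc
    have htr := isLocallyConstant_integral_conj_mul (A := ↥(unitaryGroupOfForm (conjLocal L (IsCMField.complexConj L) v) (cmLocalForm L 2 v))) (U := ((cmDatum L 1 (Matrix.of fun i j : Fin 1 => if i.val + j.val + 1 = 1 then (1 : L) else 0)).Local v)) hfH' hfHc' K₂ (cmBorelTriple L 2 v).N hKc hNcl (κ₂.prod μN₂)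
    have htr' := htr.comp_continuous (f := fun q : ↥(cmBorelTriple L 2 v).M × ((cmDatum L 1 (Matrix.of fun i j : Fin 1 => if i.val + j.val + 1 = 1 then (1 : L) else 0)).Local v) => (((q.1 : ↥(unitaryGroupOfForm (conjLocal L (IsCMField.complexConj L) v) (cmLocalForm L 2 v)))), q.2))
      ((continuous_subtype_val.comp continuous_fst).prodMk continuous_snd)
    exact ((hδ.comp_continuous continuous_fst).mul (IsLocallyConstant.const _)).mul htr'
  · -- COMPACT SUPPORT: `t ∈ proj(B₂ ∩ K⁻¹ Q K)` (compact), `u ∈ U(Φ₁)_v` (compact)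
    have hQc : IsCompact (Prod.fst '' tsupport fH) := hfHc.image continuous_fst
    have hQ'c : IsCompact ((fun p : ↥(unitaryGroupOfForm (conjLocal L (IsCMField.complexConj L) v) (cmLocalForm L 2 v)) × ↥(unitaryGroupOfForm (conjLocal L (IsCMField.complexConj L) v) (cmLocalForm L 2 v)) => p.1⁻¹ * p.2 * p.1) ''
        ((K₂ : Set ↥(unitaryGroupOfForm (conjLocal L (IsCMField.complexConj L) v) (cmLocalForm L 2 v))) ×ˢ (Prod.fst '' tsupport fH))) := (hKc.prod hQc).image (by fun_prop)
    have hBQc : IsCompact (((↑) : ↥(cmBorelTriple L 2 v).P → ↥(unitaryGroupOfForm (conjLocal L (IsCMField.complexConj L) v) (cmLocalForm L 2 v))) ⁻¹' ((fun p : ↥(unitaryGroupOfForm (conjLocal L (IsCMField.complexConj L) v) (cmLocalForm L 2 v)) × ↥(unitaryGroupOfForm (conjLocal L (IsCMField.complexConj L) v) (cmLocalForm L 2 v)) => p.1⁻¹ * p.2 * p.1) ''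
        ((K₂ : Set ↥(unitaryGroupOfForm (conjLocal L (IsCMField.complexConj L) v) (cmLocalForm L 2 v))) ×ˢ (Prod.fst '' tsupport fH)))) :=
      hBcl.isClosedEmbedding_subtypeVal.isCompact_preimage hQ'c
    have hSc : IsCompact ((cmBorelTriple L 2 v).proj '' (((↑) : ↥(cmBorelTriple L 2 v).P → ↥(unitaryGroupOfForm (conjLocal L (IsCMField.complexConj L) v) (cmLocalForm L 2 v))) ⁻¹' ((fun p : ↥(unitaryGroupOfForm (conjLocal L (IsCMField.complexConj L) v) (cmLocalForm L 2 v)) × ↥(unitaryGroupOfForm (conjLocal L (IsCMField.complexConj L) v) (cmLocalForm L 2 v)) => p.1⁻¹ * p.2 * p.1) ''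
        ((K₂ : Set ↥(unitaryGroupOfForm (conjLocal L (IsCMField.complexConj L) v) (cmLocalForm L 2 v))) ×ˢ (Prod.fst '' tsupport fH))))) :=
      hBQc.image (continuous_proj_borelTriple (conjLocal L (IsCMField.complexConj L) v) (cmLocalForm L 2 v) (cmLocalForm_eq_over L 2 v))
    refine HasCompactSupport.intro (hSc.prod hU1c) ?_
    rintro ⟨t, u⟩ htu
    rw [Set.mem_prod, not_and_or] at htu
    rcases htu with ht | hu
    · -- every integrand vanishes: otherwise `t = proj (t n)` with `t n ∈ B₂ ∩ K⁻¹ Q K`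
      have hzero : ∀ p : ↥K₂ × ↥(cmBorelTriple L 2 v).N,
          fH ((((p.1 : ↥(unitaryGroupOfForm (conjLocal L (IsCMField.complexConj L) v) (cmLocalForm L 2 v))) * ((t : ↥(unitaryGroupOfForm (conjLocal L (IsCMField.complexConj L) v) (cmLocalForm L 2 v))) * (p.2 : ↥(unitaryGroupOfForm (conjLocal L (IsCMField.complexConj L) v) (cmLocalForm L 2 v)))) * (p.1 : ↥(unitaryGroupOfForm (conjLocal L (IsCMField.complexConj L) v) (cmLocalForm L 2 v)))⁻¹ : ↥(unitaryGroupOfForm (conjLocal L (IsCMField.complexConj L) v) (cmLocalForm L 2 v))) : ((cmDatum L 2 (Matrix.of fun i j : Fin 2 => if i.val + j.val + 1 = 2 then (1 : L) else 0)).Local v)), u) = 0 := by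
        intro p
        by_contra hne
        apply ht
        have hmem : ((((p.1 : ↥(unitaryGroupOfForm (conjLocal L (IsCMField.complexConj L) v) (cmLocalForm L 2 v))) * ((t : ↥(unitaryGroupOfForm (conjLocal L (IsCMField.complexConj L) v) (cmLocalForm L 2 v))) * (p.2 : ↥(unitaryGroupOfForm (conjLocal L (IsCMField.complexConj L) v) (cmLocalForm L 2 v)))) * (p.1 : ↥(unitaryGroupOfForm (conjLocal L (IsCMField.complexConj L) v) (cmLocalForm L 2 v)))⁻¹ : ↥(unitaryGroupOfForm (conjLocal L (IsCMField.complexConj L) v) (cmLocalForm L 2 v))) : ((cmDatum L 2 (Matrix.of fun i j : Fin 2 => if i.val + j.val + 1 = 2 then (1 : L) else 0)).Local v)), u) ∈ tsupport fH := subset_tsupport _ hne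
        have hq : ((p.1 : ↥(unitaryGroupOfForm (conjLocal L (IsCMField.complexConj L) v) (cmLocalForm L 2 v))) * ((t : ↥(unitaryGroupOfForm (conjLocal L (IsCMField.complexConj L) v) (cmLocalForm L 2 v))) * (p.2 : ↥(unitaryGroupOfForm (conjLocal L (IsCMField.complexConj L) v) (cmLocalForm L 2 v)))) * (p.1 : ↥(unitaryGroupOfForm (conjLocal L (IsCMField.complexConj L) v) (cmLocalForm L 2 v)))⁻¹ : ↥(unitaryGroupOfForm (conjLocal L (IsCMField.complexConj L) v) (cmLocalForm L 2 v))) ∈ Prod.fst '' tsupport fH := ⟨_, hmem, rfl⟩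
        have hq' : ((t : ↥(unitaryGroupOfForm (conjLocal L (IsCMField.complexConj L) v) (cmLocalForm L 2 v))) * (p.2 : ↥(unitaryGroupOfForm (conjLocal L (IsCMField.complexConj L) v) (cmLocalForm L 2 v)))) ∈ (fun p : ↥(unitaryGroupOfForm (conjLocal L (IsCMField.complexConj L) v) (cmLocalForm L 2 v)) × ↥(unitaryGroupOfForm (conjLocal L (IsCMField.complexConj L) v) (cmLocalForm L 2 v)) => p.1⁻¹ * p.2 * p.1) ''
            ((K₂ : Set ↥(unitaryGroupOfForm (conjLocal L (IsCMField.complexConj L) v) (cmLocalForm L 2 v))) ×ˢ (Prod.fst '' tsupport fH)) := by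
          refine ⟨((p.1 : ↥(unitaryGroupOfForm (conjLocal L (IsCMField.complexConj L) v) (cmLocalForm L 2 v))), (p.1 : ↥(unitaryGroupOfForm (conjLocal L (IsCMField.complexConj L) v) (cmLocalForm L 2 v))) * ((t : ↥(unitaryGroupOfForm (conjLocal L (IsCMField.complexConj L) v) (cmLocalForm L 2 v))) * (p.2 : ↥(unitaryGroupOfForm (conjLocal L (IsCMField.complexConj L) v) (cmLocalForm L 2 v)))) * (p.1 : ↥(unitaryGroupOfForm (conjLocal L (IsCMField.complexConj L) v) (cmLocalForm L 2 v)))⁻¹), ⟨p.1.2, hq⟩, ?_⟩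
          show (p.1 : ↥(unitaryGroupOfForm (conjLocal L (IsCMField.complexConj L) v) (cmLocalForm L 2 v)))⁻¹ * ((p.1 : ↥(unitaryGroupOfForm (conjLocal L (IsCMField.complexConj L) v) (cmLocalForm L 2 v))) * ((t : ↥(unitaryGroupOfForm (conjLocal L (IsCMField.complexConj L) v) (cmLocalForm L 2 v))) * (p.2 : ↥(unitaryGroupOfForm (conjLocal L (IsCMField.complexConj L) v) (cmLocalForm L 2 v)))) * (p.1 : ↥(unitaryGroupOfForm (conjLocal L (IsCMField.complexConj L) v) (cmLocalForm L 2 v)))⁻¹) * (p.1 : ↥(unitaryGroupOfForm (conjLocal L (IsCMField.complexConj L) v) (cmLocalForm L 2 v))) = (t : ↥(unitaryGroupOfForm (conjLocal L (IsCMField.complexConj L) v) (cmLocalForm L 2 v))) * (p.2 : ↥(unitaryGroupOfForm (conjLocal L (IsCMField.complexConj L) v) (cmLocalForm L 2 v)))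
          group
        have htn : (t : ↥(unitaryGroupOfForm (conjLocal L (IsCMField.complexConj L) v) (cmLocalForm L 2 v))) * (p.2 : ↥(unitaryGroupOfForm (conjLocal L (IsCMField.complexConj L) v) (cmLocalForm L 2 v))) ∈ (cmBorelTriple L 2 v).P :=
          (cmBorelTriple L 2 v).P.mul_mem ((cmBorelTriple L 2 v).M_le t.2) ((cmBorelTriple L 2 v).N_le p.2.2)
        refine ⟨⟨(t : ↥(unitaryGroupOfForm (conjLocal L (IsCMField.complexConj L) v) (cmLocalForm L 2 v))) * (p.2 : ↥(unitaryGroupOfForm (conjLocal L (IsCMField.complexConj L) v) (cmLocalForm L 2 v))), htn⟩, hq', ?_⟩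
        -- `proj (t n) = t`
        have hsplit : (⟨(t : ↥(unitaryGroupOfForm (conjLocal L (IsCMField.complexConj L) v) (cmLocalForm L 2 v))) * (p.2 : ↥(unitaryGroupOfForm (conjLocal L (IsCMField.complexConj L) v) (cmLocalForm L 2 v))), htn⟩ : ↥(cmBorelTriple L 2 v).P) =
            ⟨(t : ↥(unitaryGroupOfForm (conjLocal L (IsCMField.complexConj L) v) (cmLocalForm L 2 v))), (cmBorelTriple L 2 v).M_le t.2⟩ * ⟨(p.2 : ↥(unitaryGroupOfForm (conjLocal L (IsCMField.complexConj L) v) (cmLocalForm L 2 v))), (cmBorelTriple L 2 v).N_le p.2.2⟩ := rfl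
        rw [hsplit, map_mul, (cmBorelTriple L 2 v).proj_apply_of_mem_N ⟨(p.2 : ↥(unitaryGroupOfForm (conjLocal L (IsCMField.complexConj L) v) (cmLocalForm L 2 v))), (cmBorelTriple L 2 v).N_le p.2.2⟩ p.2.2, mul_one]
        exact Subtype.ext ((cmBorelTriple L 2 v).proj_apply_of_mem_M _ t.2)
      simp only [hzero, integral_zero, mul_zero]
    · exact absurd (Set.mem_univ u) hu
  · -- THE IDENTITY at a regular good point: ★ FILE 2′ and `J₂ · J₂⁻¹ = 1`
    intro t u d hd hb hreg hPH
    have hO := classOrbitalIntegral_prod_eq_smul_integral_prod_of_torus_regular_of_nonsplit L w hw νH hmH K₂ hK2 κ₂ μN₂ t hd hb hreg u hPH hK₁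
      fH hfH.continuous.measurable
    beta_reduce
    rw [hO, Complex.real_smul, ENNReal.toReal_mul, ENNReal.coe_toReal, Complex.ofReal_mul]
    -- `J₂(t) ≠ 0`
    have hJ : (((letI : MeasurableSpace (LocalRing L v) := borel _; haveI : BorelSpace (LocalRing L v) := ⟨rfl⟩
            haveI : SecondCountableTopology (LocalRing L v) := secondCountableTopology_localRing (E := L) v
            ((skewModulus (conjLocal L (IsCMField.complexConj L) v) (continuous_conjLocal L (IsCMField.complexConj L) v) hb.unit
              (map_unit_torusScalar_sub_one_two (conjLocal L (IsCMField.complexConj L) v) (cmLocalForm_eq_over L 2 v)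
                (⟨(t : ↥(unitaryGroupOfForm (conjLocal L (IsCMField.complexConj L) v) (cmLocalForm L 2 v))), t.2⟩ : ↥(torusU (conjLocal L (IsCMField.complexConj L) v) (cmLocalForm L 2 v))) hd hb))⁻¹ : ℝ≥0)) : ℝ) : ℂ) ≠ 0 := by
      letI : MeasurableSpace (LocalRing L v) := borel _
      haveI : BorelSpace (LocalRing L v) := ⟨rfl⟩
      haveI : SecondCountableTopology (LocalRing L v) := secondCountableTopology_localRing (E := L) v
      have h0 : ((skewModulus (conjLocal L (IsCMField.complexConj L) v) (continuous_conjLocal L (IsCMField.complexConj L) v) hb.unit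
              (map_unit_torusScalar_sub_one_two (conjLocal L (IsCMField.complexConj L) v) (cmLocalForm_eq_over L 2 v)
                (⟨(t : ↥(unitaryGroupOfForm (conjLocal L (IsCMField.complexConj L) v) (cmLocalForm L 2 v))), t.2⟩ : ↥(torusU (conjLocal L (IsCMField.complexConj L) v) (cmLocalForm L 2 v))) hd hb))⁻¹ : ℝ≥0) ≠ 0 :=
        inv_ne_zero (skewModulus_pos _ _ _ _).ne'
      exact_mod_cast NNReal.coe_ne_zero.2 h0
    set J : ℂ := (((letI : MeasurableSpace (LocalRing L v) := borel _; haveI : BorelSpace (LocalRing L v) := ⟨rfl⟩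
            haveI : SecondCountableTopology (LocalRing L v) := secondCountableTopology_localRing (E := L) v
            ((skewModulus (conjLocal L (IsCMField.complexConj L) v) (continuous_conjLocal L (IsCMField.complexConj L) v) hb.unit
              (map_unit_torusScalar_sub_one_two (conjLocal L (IsCMField.complexConj L) v) (cmLocalForm_eq_over L 2 v)
                (⟨(t : ↥(unitaryGroupOfForm (conjLocal L (IsCMField.complexConj L) v) (cmLocalForm L 2 v))), t.2⟩ : ↥(torusU (conjLocal L (IsCMField.complexConj L) v) (cmLocalForm L 2 v))) hd hb))⁻¹ : ℝ≥0)) : ℝ) : ℂ) with hJdef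
    set δ : ℂ := ((rootDeltaChar (cmBorelTriple L 2 v).P ⟨(t : ↥(unitaryGroupOfForm (conjLocal L (IsCMField.complexConj L) v) (cmLocalForm L 2 v))), (cmBorelTriple L 2 v).M_le t.2⟩ : ℂˣ) : ℂ) with hδdef
    set I : ℂ := ∫ p : ↥K₂ × ↥(cmBorelTriple L 2 v).N,
          fH ((((p.1 : ↥(unitaryGroupOfForm (conjLocal L (IsCMField.complexConj L) v) (cmLocalForm L 2 v))) * ((t : ↥(unitaryGroupOfForm (conjLocal L (IsCMField.complexConj L) v) (cmLocalForm L 2 v))) * (p.2 : ↥(unitaryGroupOfForm (conjLocal L (IsCMField.complexConj L) v) (cmLocalForm L 2 v)))) * (p.1 : ↥(unitaryGroupOfForm (conjLocal L (IsCMField.complexConj L) v) (cmLocalForm L 2 v)))⁻¹ : ↥(unitaryGroupOfForm (conjLocal L (IsCMField.complexConj L) v) (cmLocalForm L 2 v))) : ((cmDatum L 2 (Matrix.of fun i j : Fin 2 => if i.val + j.val + 1 = 2 then (1 : L) else 0)).Local v)), u) ∂(κ₂.prod μN₂) with hIdef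
    set c : ℂ := ((cF.toReal : ℝ) : ℂ) with hcdef
    rw [show δ * J⁻¹ * (c * J * I) = δ * c * I * (J⁻¹ * J) by ring, inv_mul_cancel₀ hJ, mul_one]

/-! ## §3 D3-ii-H from the spectral data alone -/

set_option maxHeartbeats 3200000 in
set_option synthInstance.maxHeartbeats 400000 in
/-- **D3-ii-H «SHELL-ORBITAL — H TWIN», `Ψ`-FREE FORM.**  Frame of ★ `smoothTrace_cmPrincipalSeriesH_eq_inv_mul_integral` (Haar `μ_T` on `T₂`, `ν₁` on `U(Φ₁)_v`, regularity ∕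
`P_H`-goodness a.e. `hae`), shell data `(C₂, K₁, b₁, b₂, z₁, A, κ)` and the spectral hypothesis `hF1H` BY SHAPE (★ p849562's): then at EVERY `t ∈ T₂` with a diagonal writing
`t = diag(d)` (`d₀⁻¹d₁ − 1` a unit), `t` regular, and every `u` with `(t, u)` `P_H`-good,
`O^{can}_{(t,u)}(f_H) = δ_{B₂}^{1∕2}(t)⁻¹ · J₂(t) · κ_H · (𝟙_{(b₁,z₁)(C₂×K₁)}(t,u) + κ·𝟙_{(b₂,z₁)(C₂×K₁)}(t,u))`, `κ_H = A · μ_T{t ∈ K_{2,v}} · ν₁(univ) ∕ (μ_T(C₂) · ν₁(K₁))`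
— ★ p849562 `classOrbitalIntegralH_eq_twoCoset_apply` with its `Ψ`-hypotheses DISCHARGED by §2.  For the shell indicator `f_H = 𝟙_{K₂b₂K₂} ⊗ 𝟙_{z₁K₁}`, `hF1H` is ★ p849597
(`F0P3cStCharTSShellTracePSH`). [cite: Rogawski1990, §4.9 (4.9.4) p. 56; §12.7 Lemma 12.7.3 (proof) p. 195] [cite: HewittRoss1979, Thm. (23.11)] [cite: BernsteinZelevinsky1976, §1.1] -/
theorem classOrbitalIntegralH_eq_twoCoset_of_spectral
    {v : HeightOneSpectrum (𝓞 ↥(maximalRealSubfield L))} (w : PlacesOver L v) (hw : IsCMField.complexConj L • w.1 = w.1)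
    [mHH : MeasurableSpace (((cmDatum L 2 (Matrix.of fun i j : Fin 2 => if i.val + j.val + 1 = 2 then (1 : L) else 0)).Local v) × ((cmDatum L 1 (Matrix.of fun i j : Fin 1 => if i.val + j.val + 1 = 1 then (1 : L) else 0)).Local v))] [BorelSpace (((cmDatum L 2 (Matrix.of fun i j : Fin 2 => if i.val + j.val + 1 = 2 then (1 : L) else 0)).Local v) × ((cmDatum L 1 (Matrix.of fun i j : Fin 1 => if i.val + j.val + 1 = 1 then (1 : L) else 0)).Local v))]
    [∀ a : (((cmDatum L 2 (Matrix.of fun i j : Fin 2 => if i.val + j.val + 1 = 2 then (1 : L) else 0)).Local v) × ((cmDatum L 1 (Matrix.of fun i j : Fin 1 => if i.val + j.val + 1 = 1 then (1 : L) else 0)).Local v)), MeasurableSpace ((((cmDatum L 2 (Matrix.of fun i j : Fin 2 => if i.val + j.val + 1 = 2 then (1 : L) else 0)).Local v) × ((cmDatum L 1 (Matrix.of fun i j : Fin 1 => if i.val + j.val + 1 = 1 then (1 : L) else 0)).Local v)) ⧸ Subgroup.centralizer ({a} : Set (((cmDatum L 2 (Matrix.of fun i j : Fin 2 => if i.val +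 j.val + 1 = 2 then (1 : L) else 0)).Local v) × ((cmDatum L 1 (Matrix.of fun i j : Fin 1 => if i.val + j.val + 1 = 1 then (1 : L) else 0)).Local v))))]
    [∀ a : (((cmDatum L 2 (Matrix.of fun i j : Fin 2 => if i.val + j.val + 1 = 2 then (1 : L) else 0)).Local v) × ((cmDatum L 1 (Matrix.of fun i j : Fin 1 => if i.val + j.val + 1 = 1 then (1 : L) else 0)).Local v)), BorelSpace ((((cmDatum L 2 (Matrix.of fun i j : Fin 2 => if i.val + j.val + 1 = 2 then (1 : L) else 0)).Local v) × ((cmDatum L 1 (Matrix.of fun i j : Fin 1 => if i.val + j.val + 1 = 1 then (1 : L) else 0)).Local v)) ⧸ Subgroup.centralizer ({a} : Set (((cmDatum L 2 (Matrix.of fun i j : Fin 2 => if i.val + j.val + 1 = 2 then (1 : L) else 0)).Local v) × ((cmDatum L 1 (Matrix.of fun i j : Fin 1 => if i.val + j.val + 1 = 1 then (1 : L) else 0)).Local v))))]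
    (νH : Measure (((cmDatum L 2 (Matrix.of fun i j : Fin 2 => if i.val + j.val + 1 = 2 then (1 : L) else 0)).Local v) × ((cmDatum L 1 (Matrix.of fun i j : Fin 1 => if i.val + j.val + 1 = 1 then (1 : L) else 0)).Local v))) [νH.IsHaarMeasure] [νH.IsMulRightInvariant]
    {P_H : (((cmDatum L 2 (Matrix.of fun i j : Fin 2 => if i.val + j.val + 1 = 2 then (1 : L) else 0)).Local v) × ((cmDatum L 1 (Matrix.of fun i j : Fin 1 => if i.val + j.val + 1 = 1 then (1 : L) else 0)).Local v)) → Prop} {mH : OrbitalMeasureFamily (((cmDatum L 2 (Matrix.of fun i j : Fin 2 => if i.val + j.val + 1 = 2 then (1 : L) else 0)).Local v) × ((cmDatum L 1 (Matrix.of fun i j : Fin 1 => if i.val + j.val + 1 = 1 then (1 : L) else 0)).Local v))} (hmH : mH.IsCanonical P_H νH)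
    [MeasurableSpace ↥(unitaryGroupOfForm (conjLocal L (IsCMField.complexConj L) v) (cmLocalForm L 2 v))] [BorelSpace ↥(unitaryGroupOfForm (conjLocal L (IsCMField.complexConj L) v) (cmLocalForm L 2 v))] [MeasurableSpace ((cmDatum L 1 (Matrix.of fun i j : Fin 1 => if i.val + j.val + 1 = 1 then (1 : L) else 0)).Local v)] [BorelSpace ((cmDatum L 1 (Matrix.of fun i j : Fin 1 => if i.val + j.val + 1 = 1 then (1 : L) else 0)).Local v)]
    (μT : Measure ↥(cmBorelTriple L 2 v).M) [μT.IsHaarMeasure] (ν₁ : Measure ((cmDatum L 1 (Matrix.of fun i j : Fin 1 => if i.val + j.val + 1 = 1 then (1 : L) else 0)).Local v)) [ν₁.IsHaarMeasure]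
    (hK₁ : ∀ x : ((cmDatum L 1 (Matrix.of fun i j : Fin 1 => if i.val + j.val + 1 = 1 then (1 : L) else 0)).Local v), x ∈ cmLocalIntegralLevel L 1 (Matrix.of fun i j : Fin 1 => if i.val + j.val + 1 = 1 then (1 : L) else 0) v)
    (fH : (((cmDatum L 2 (Matrix.of fun i j : Fin 2 => if i.val + j.val + 1 = 2 then (1 : L) else 0)).Local v) × ((cmDatum L 1 (Matrix.of fun i j : Fin 1 => if i.val + j.val + 1 = 1 then (1 : L) else 0)).Local v)) → ℂ) (hfH : IsLocallyConstant fH) (hfHc : HasCompactSupport fH)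
    (hae : ∀ᵐ t : ↥(cmBorelTriple L 2 v).M ∂μT, ∀ᵐ u : ((cmDatum L 1 (Matrix.of fun i j : Fin 1 => if i.val + j.val + 1 = 1 then (1 : L) else 0)).Local v) ∂ν₁,
      IsRegularElt ((t : ↥(unitaryGroupOfForm (conjLocal L (IsCMField.complexConj L) v) (cmLocalForm L 2 v))) : GL (Fin 2) (LocalRing L v)) ∧ P_H (Quotient.out (ConjClasses.mk (((t : ↥(unitaryGroupOfForm (conjLocal L (IsCMField.complexConj L) v) (cmLocalForm L 2 v))) : ((cmDatum L 2 (Matrix.of fun i j : Fin 2 => if i.val + j.val + 1 = 2 then (1 : L) else 0)).Local v)), u))))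
    (C₂ : Subgroup ↥(cmBorelTriple L 2 v).M) (hC₂o : IsOpen (C₂ : Set ↥(cmBorelTriple L 2 v).M)) (hC₂c : IsCompact (C₂ : Set ↥(cmBorelTriple L 2 v).M))
    (K₁ : Subgroup ((cmDatum L 1 (Matrix.of fun i j : Fin 1 => if i.val + j.val + 1 = 1 then (1 : L) else 0)).Local v)) (hK₁o : IsOpen (K₁ : Set ((cmDatum L 1 (Matrix.of fun i j : Fin 1 => if i.val + j.val + 1 = 1 then (1 : L) else 0)).Local v))) (hK₁c : IsCompact (K₁ : Set ((cmDatum L 1 (Matrix.of fun i j : Fin 1 => if i.val + j.val + 1 = 1 then (1 : L) else 0)).Local v)))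
    (b₁ b₂ : ↥(cmBorelTriple L 2 v).M) (z₁ : ((cmDatum L 1 (Matrix.of fun i j : Fin 1 => if i.val + j.val + 1 = 1 then (1 : L) else 0)).Local v)) (A κ : ℂ)
    (hF1H : haveI := locallyCompactSpace_cmBorelU L 2 v
      ∀ (χ₂ : ↥(torusU (conjLocal L (IsCMField.complexConj L) v) (cmLocalForm L 2 v)) →* ℂˣ) (_hχ₂ : Continuous fun t => ((χ₂ t : ℂˣ) : ℂ))
        (χ₁ : ((cmDatum L 1 (Matrix.of fun i j : Fin 1 => if i.val + j.val + 1 = 1 then (1 : L) else 0)).Local v) →* ℂˣ) (_hχ₁ : IsOpen ((χ₁.ker : Subgroup ((cmDatum L 1 (Matrix.of fun i j : Fin 1 => if i.val + j.val + 1 = 1 then (1 : L) else 0)).Local v)) : Set ((cmDatum L 1 (Matrix.of fun i j : Fin 1 => if i.val + j.val + 1 = 1 then (1 : L) else 0)).Local v))),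
        (cmPrincipalSeriesH L v χ₂ χ₁).smoothTrace νH fH =
          if (∀ c ∈ C₂, χ₂ c = 1) ∧ (∀ k ∈ K₁, χ₁ k = 1)
          then A * ((χ₁ z₁ : ℂˣ) : ℂ) * (((χ₂ b₁ : ℂˣ) : ℂ) + κ * ((χ₂ b₂ : ℂˣ) : ℂ)) else 0)
    -- the point and its diagonal writing
    (t : ↥(cmBorelTriple L 2 v).M) (u : ((cmDatum L 1 (Matrix.of fun i j : Fin 1 => if i.val + j.val + 1 = 1 then (1 : L) else 0)).Local v)) (d : Fin 2 → (LocalRing L v)ˣ)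
    (hd : glDiagonal 2 (LocalRing L v) d = ((t : ↥(unitaryGroupOfForm (conjLocal L (IsCMField.complexConj L) v) (cmLocalForm L 2 v))) : GL (Fin 2) (LocalRing L v)))
    (hb : IsUnit ((((d 0)⁻¹ * d 1 : (LocalRing L v)ˣ) : LocalRing L v) - 1))
    (hreg : IsRegularElt ((t : ↥(unitaryGroupOfForm (conjLocal L (IsCMField.complexConj L) v) (cmLocalForm L 2 v))) : GL (Fin 2) (LocalRing L v)))
    (hPH : P_H (Quotient.out (ConjClasses.mk (((t : ↥(unitaryGroupOfForm (conjLocal L (IsCMField.complexConj L) v) (cmLocalForm L 2 v))) : ((cmDatum L 2 (Matrix.of fun i j : Fin 2 => if i.val + j.val + 1 = 2 then (1 : L) else 0)).Local v)), u)))) :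
    haveI := locallyCompactSpace_cmBorelU L 2 v
    classOrbitalIntegral mH fH (ConjClasses.mk (((t : ↥(unitaryGroupOfForm (conjLocal L (IsCMField.complexConj L) v) (cmLocalForm L 2 v))) : ((cmDatum L 2 (Matrix.of fun i j : Fin 2 => if i.val + j.val + 1 = 2 then (1 : L) else 0)).Local v)), u)) =
      ((rootDeltaChar (cmBorelTriple L 2 v).P ⟨(t : ↥(unitaryGroupOfForm (conjLocal L (IsCMField.complexConj L) v) (cmLocalForm L 2 v))), (cmBorelTriple L 2 v).M_le t.2⟩ : ℂˣ) : ℂ)⁻¹ *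
        (((letI : MeasurableSpace (LocalRing L v) := borel _; haveI : BorelSpace (LocalRing L v) := ⟨rfl⟩
          haveI : SecondCountableTopology (LocalRing L v) := secondCountableTopology_localRing (E := L) v
          ((skewModulus (conjLocal L (IsCMField.complexConj L) v) (continuous_conjLocal L (IsCMField.complexConj L) v) hb.unit
            (map_unit_torusScalar_sub_one_two (conjLocal L (IsCMField.complexConj L) v) (cmLocalForm_eq_over L 2 v)
              (⟨(t : ↥(unitaryGroupOfForm (conjLocal L (IsCMField.complexConj L) v) (cmLocalForm L 2 v))), t.2⟩ : ↥(torusU (conjLocal L (IsCMField.complexConj L) v) (cmLocalForm L 2 v))) hd hb))⁻¹ : ℝ≥0)) : ℝ) : ℂ) *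
      ((A * ((μT.real {t : ↥(cmBorelTriple L 2 v).M | (t : ↥(unitaryGroupOfForm (conjLocal L (IsCMField.complexConj L) v) (cmLocalForm L 2 v))) ∈ cmLocalIntegralLevel L 2 (Matrix.of fun i j : Fin 2 => if i.val + j.val + 1 = 2 then (1 : L) else 0) v} * ν₁.real Set.univ : ℝ) : ℂ)) /
          ((μT.real (C₂ : Set ↥(cmBorelTriple L 2 v).M) * ν₁.real (K₁ : Set ((cmDatum L 1 (Matrix.of fun i j : Fin 1 => if i.val + j.val + 1 = 1 then (1 : L) else 0)).Local v)) : ℝ) : ℂ) *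
        ({x : ↥(cmBorelTriple L 2 v).M × ((cmDatum L 1 (Matrix.of fun i j : Fin 1 => if i.val + j.val + 1 = 1 then (1 : L) else 0)).Local v) | (b₁, z₁)⁻¹ * x ∈ ((C₂.prod K₁ : Subgroup (↥(cmBorelTriple L 2 v).M × ((cmDatum L 1 (Matrix.of fun i j : Fin 1 => if i.val + j.val + 1 = 1 then (1 : L) else 0)).Local v))) : Set (↥(cmBorelTriple L 2 v).M × ((cmDatum L 1 (Matrix.of fun i j : Fin 1 => if i.val + j.val + 1 = 1 then (1 : L) else 0)).Local v)))}.indicator (fun _ => (1 : ℂ)) (t, u) +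
          κ * {x : ↥(cmBorelTriple L 2 v).M × ((cmDatum L 1 (Matrix.of fun i j : Fin 1 => if i.val + j.val + 1 = 1 then (1 : L) else 0)).Local v) | (b₂, z₁)⁻¹ * x ∈ ((C₂.prod K₁ : Subgroup (↥(cmBorelTriple L 2 v).M × ((cmDatum L 1 (Matrix.of fun i j : Fin 1 => if i.val + j.val + 1 = 1 then (1 : L) else 0)).Local v))) : Set (↥(cmBorelTriple L 2 v).M × ((cmDatum L 1 (Matrix.of fun i j : Fin 1 => if i.val + j.val + 1 = 1 then (1 : L) else 0)).Local v)))}.indicator (fun _ => (1 : ℂ)) (t, u))) := by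
  haveI := locallyCompactSpace_cmBorelU L 2 v
  obtain ⟨Ψ, hΨlc, hΨK, hΨpt⟩ := exists_normalizedOrbitalIntegralH_version L w hw νH hmH hK₁ fH hfH hfHc
  exact classOrbitalIntegralH_eq_twoCoset_apply L w hw νH hmH μT ν₁ hK₁ fH hfH hfHc hae C₂ hC₂o hC₂c K₁ hK₁o hK₁c b₁ b₂ z₁ A κ
    hF1H Ψ hΨlc hΨK
    (Filter.Eventually.of_forall fun t' => Filter.Eventually.of_forall fun u' => fun d' hd' hb' hreg' hP' => hΨpt t' u' d' hd' hb' hreg' hP')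
    t u d hd hb (hΨpt t u d hd hb hreg hPH)

end CM

end Summit.HodgeConjecture.HodgeConjecture.Cruxes.H413.F0P3cStCharTSNormalizedOrbitalH

end
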